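import Literature.Geometry.Lorentzian.KerrStarSlices
import HarnessLib

/-!
# The Laplacian pair condition for angular slices on Kerr against the spherical harmonics

Dafermos–Rodnianski–Shlapentokh-Rothman, arXiv:1402.7034, §5.2.2–5.2.3. Companion of
`KerrStarAngularSeparation` (`Kerr.inner_oblateSphereBasis_sliceLap`, the pairing of the angular
Laplacian slice with the oblate spheroidal basis `Ψ_q(ν)`): here the same integration by parts is
concluded against the *fixed, smooth* basis `Y_{m,k} = sphHarmTensor (2π) m k`
(`inner_sphHarmTensor_polarLp_laplacian`):

* `Kerr.inner_sphHarmTensor_sliceLap`: `⟪Y_{m,k}, 𝓛(Δ̸F|_{t*,r})⟫ = -Λ_{|m|,k} ⟪Y_{m,k}, 𝓛(F|)⟫`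
  for `Φ ∈ C²(ℝ⁴)`, `F = Φ ∘ κ_a`, `r > 0`, and its `angSlice` form.

These are the countably many `ν`-independent conditions ("weak Laplacian pair",
`oblateSphere_weak_of_pair`) that survive the a.e.-in-frequency transport of §5.2.2, after which
the eigen-identity for `Ψ_q(aω)` is recovered for the frequency `ω` at hand.

## References

* M. Dafermos, I. Rodnianski, Y. Shlapentokh-Rothman, arXiv:1402.7034, §5.2.2, Prop. 5.2.1.
  [DafermosRodnianskiShlapentokhrothman2014]
-/

noncomputable section

open Real Set Filter MeasureTheory
open scoped Topology InnerProductSpace ComplexConjugate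

namespace Literature.Geometry.Lorentzian

namespace Kerr

open Literature.Analysis.SpecialFunctions Literature.Analysis.FunctionSpaces
  Literature.Analysis.Fourier

variable [h2π : Fact (0 < 2 * π)]

/-- **The Laplacian pair condition for Kerr slices**: for `Φ ∈ C²(ℝ⁴)`, `r > 0` and every
`(m, k)`, `⟪Y_{m,k}, 𝓛(Δ̸F|_{t*,r})⟫ = -Λ_{|m|,k} ⟪Y_{m,k}, 𝓛(F|_{t*,r})⟫`, `F = Φ ∘ κ_a`
(`Y_{m,k} = sphHarmTensor`, `Λ = assocLegLevel`).
[cite: DafermosRodnianskiShlapentokhrothman2014, §5.2.2] -/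
theorem inner_sphHarmTensor_sliceLap (a : ℝ) {Φ : E4 → ℝ} (hΦ : ContDiff ℝ 2 Φ) {t r : ℝ}
    (hr : 0 < r) (m : ℤ) (k : ℕ) :
    ⟪sphHarmTensor (2 * π) m k,
        polarLp (2 * π) (sliceLap a Φ t r) (continuous_sliceLap a t r hΦ)⟫_ℂ =
      -(assocLegLevel m.natAbs k : ℂ) *
        ⟪sphHarmTensor (2 * π) m k,
          polarLp (2 * π) (sliceFn a Φ t r) (continuous_sliceFn a t r hΦ)⟫_ℂ := by
  set F : E4 → ℝ := starPull a Φ with hFdef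
  have hF : ContDiff ℝ 2 F := hΦ.comp (contDiff_starChart a)
  have hFd : ∀ q, DifferentiableAt ℝ F q := fun q ↦ hF.differentiable two_ne_zero q
  -- the data of `oblateSphere_weak_polar`
  set e₂ : E4 := E4.basisVector 2
  set e₃ : E4 := E4.basisVector 3
  set g : ℝ → ℝ → ℂ := sliceFn a Φ t r with hgdef
  set gθ : ℝ → ℝ → ℂ := fun θ φ ↦ (fderiv ℝ F (starq t r θ φ) e₂ : ℂ) with hgθdef
  set w : ℝ → ℝ → ℂ := fun θ φ ↦ ((cos θ * fderiv ℝ F (starq t r θ φ) e₂ +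
    sin θ * fderiv ℝ (fderiv ℝ F) (starq t r θ φ) e₂ e₂ : ℝ) : ℂ) with hwdef
  set gφ : ℝ → ℝ → ℂ := fun θ φ ↦ (fderiv ℝ F (starq t r θ φ) e₃ : ℂ) with hgφdef
  set gφφ : ℝ → ℝ → ℂ := fun θ φ ↦ (fderiv ℝ (fderiv ℝ F) (starq t r θ φ) e₃ e₃ : ℂ) with hgφφdef
  set h : ℝ → ℝ → ℂ := fun θ φ ↦ -sliceLap a Φ t r θ φ with hhdef
  have hgθ : ∀ θ φ, HasDerivAt (fun θ ↦ g θ φ) (gθ θ φ) θ := fun θ φ ↦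
    (hasDerivAt_comp_starq_theta t r θ φ (hFd _)).ofReal_comp
  have hw : ∀ θ φ, HasDerivAt (fun θ ↦ (sin θ : ℂ) * gθ θ φ) (w θ φ) θ := by
    intro θ φ
    have h1 := (hasDerivAt_sin θ).mul (hasDerivAt_fderiv_comp_starq_theta hF t r θ φ e₂)
    have h2 := h1.ofReal_comp
    have hfun : (fun θ ↦ (sin θ : ℂ) * gθ θ φ) =
        fun y ↦ ((sin y * fderiv ℝ F (starq t r y φ) e₂ : ℝ) : ℂ) := by
      funext y
      rw [hgθdef]
      push_cast
      ring
    rw [hfun]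
    refine h2.congr_deriv ?_
    rw [hwdef]
  have hgφ : ∀ θ φ, HasDerivAt (g θ) (gφ θ φ) φ := fun θ φ ↦
    (hasDerivAt_comp_starq_phi t r θ φ (hFd _)).ofReal_comp
  have hgφφ : ∀ θ φ, HasDerivAt (gφ θ) (gφφ θ φ) φ := fun θ φ ↦
    (hasDerivAt_fderiv_comp_starq_phi hF t r θ φ e₃).ofReal_comp
  have hcg : Continuous (Function.uncurry g) := continuous_sliceFn a t r hΦ
  have hcgθ : Continuous (Function.uncurry gθ) :=
    Complex.continuous_ofReal.comp (continuous_fderiv_comp_starq hF two_ne_zero t r e₂)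
  have hcw : Continuous (Function.uncurry w) := by
    refine Complex.continuous_ofReal.comp ?_
    exact ((continuous_cos.comp continuous_fst).mul
      (continuous_fderiv_comp_starq hF two_ne_zero t r e₂)).add
      ((continuous_sin.comp continuous_fst).mul (continuous_fderiv_fderiv_comp_starq hF t r e₂ e₂))
  have hcgφφ : Continuous (Function.uncurry gφφ) :=
    Complex.continuous_ofReal.comp (continuous_fderiv_fderiv_comp_starq hF t r e₃ e₃)
  have hch : Continuous (Function.uncurry h) := (continuous_sliceLap a t r hΦ).neg
  have hper : ∀ θ φ, g θ (φ + 2 * π) = g θ φ := by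
    intro θ φ
    rw [hgdef, sliceFn_apply, sliceFn_apply, starq_add_phi, starPull_add_two_pi]
  have hperφ : ∀ θ φ, gφ θ (φ + 2 * π) = gφ θ φ := by
    intro θ φ
    simp only [hgφdef]
    rw [starq_add_phi, hFdef, fderiv_starPull_add_two_pi]
  have hrel : ∀ θ φ, (sin θ : ℂ) ^ 2 * h θ φ = -(sin θ : ℂ) * w θ φ - gφφ θ φ := by
    intro θ φ
    by_cases hs : sin θ = 0
    · -- at the poles everything vanishes: `∂₃F = ∂₃∂₃F = 0` there
      have hconst : ∀ φ', F (starq t r θ φ') = F (starq t r θ 0) := fun φ' ↦ by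
        rw [hFdef, starPull_apply, starPull_apply, starChart_starq_of_sin_eq_zero a hs φ',
          starChart_starq_of_sin_eq_zero a hs 0]
      have h3 : ∀ φ', fderiv ℝ F (starq t r θ φ') e₃ = 0 := fun φ' ↦ by
        have hd := hasDerivAt_comp_starq_phi t r θ φ' (hFd _)
        have hc : HasDerivAt (fun φ'' ↦ F (starq t r θ φ'')) 0 φ' := by
          have : (fun φ'' ↦ F (starq t r θ φ'')) = fun _ ↦ F (starq t r θ 0) := funext hconst
          rw [this]
          exact hasDerivAt_const _ _
        exact hd.unique hc
      have h33 : fderiv ℝ (fderiv ℝ F) (starq t r θ φ) e₃ e₃ = 0 := by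
        have hd := hasDerivAt_fderiv_comp_starq_phi hF t r θ φ e₃
        have hc : HasDerivAt (fun φ' ↦ fderiv ℝ F (starq t r θ φ') e₃) 0 φ := by
          have : (fun φ' ↦ fderiv ℝ F (starq t r θ φ') e₃) = fun _ ↦ (0 : ℝ) := funext h3
          rw [this]
          exact hasDerivAt_const _ _
        exact hd.unique hc
      rw [hgφφdef]
      simp only [hs, h33, Complex.ofReal_zero]
      ring
    · have hq1 : 0 < starq t r θ φ 1 := by rwa [starq_apply_one]
      have hq2 : sin (starq t r θ φ 2) ≠ 0 := by rwa [starq_apply_two]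
      have hreal : sin θ ^ 2 * (-sphLaplacianStar a Φ (starq t r θ φ)) =
          -sin θ * (cos θ * fderiv ℝ F (starq t r θ φ) e₂ +
            sin θ * fderiv ℝ (fderiv ℝ F) (starq t r θ φ) e₂ e₂) -
            fderiv ℝ (fderiv ℝ F) (starq t r θ φ) e₃ e₃ := by
        rw [sphLaplacianStar_eq hq1 hq2 hΦ.contDiffAt, starq_apply_two]
        field_simp
        ring
      rw [hhdef, hwdef, hgφφdef]
      simp only [sliceLap_apply]
      exact_mod_cast hreal
  have hlap := inner_sphHarmTensor_polarLp_laplacian m k hgθ hw hgφ hgφφ hcg hcgθ hcw hcgφφ hch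
    hper hperφ hrel
  rw [show polarLp (2 * π) h hch =
      -polarLp (2 * π) (sliceLap a Φ t r) (continuous_sliceLap a t r hΦ)
    from polarLp_neg _ (continuous_sliceLap a t r hΦ) hch, inner_neg_right] at hlap
  linear_combination -hlap

/-- The same for the `𝓚`-valued slices `angSlice`. [folklore] -/
theorem inner_sphHarmTensor_angSlice_sphLaplacianStar (a : ℝ) {Φ : E4 → ℝ} (hΦ : ContDiff ℝ 2 Φ)
    {t r : ℝ} (hr : 0 < r) (m : ℤ) (k : ℕ) :
    ⟪sphHarmTensor (2 * π) m k,
        angSlice (sphLaplacianStar a Φ) (continuous_sphLaplacianStar a hΦ) t r⟫_ℂ =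
      -(assocLegLevel m.natAbs k : ℂ) *
        ⟪sphHarmTensor (2 * π) m k,
          angSlice (starPull a Φ) (hΦ.comp (contDiff_starChart a)).continuous t r⟫_ℂ :=
  inner_sphHarmTensor_sliceLap a hΦ hr m k

end Kerr

end Literature.Geometry.Lorentzian
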